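import Mathlib
import HarnessLib
import Summits.AnomalousDissipation.AnomalousDissipation.Theses.PointSink
import Literature.Analysis.FunctionSpaces.TorusTestFunction
import Summits.AnomalousDissipation.AnomalousDissipation.Theorems.PointSinkSolitonTransplantStubShellDefectScaling
import Summits.AnomalousDissipation.AnomalousDissipation.Theorems.PointSinkSolitonTransplantStubLocalL2Convergence
import Summits.AnomalousDissipation.AnomalousDissipation.Theorems.PointSinkSolitonTransplantStubTestedRescaledNS
import Summits.AnomalousDissipation.AnomalousDissipation.Theorems.PointSinkSolitonTransplantStubFarFieldWeakEuler
import Summits.AnomalousDissipation.AnomalousDissipation.Theorems.PointSinkSolitonTransplantStubTunedTorusPlanting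
import Summits.AnomalousDissipation.AnomalousDissipation.Theorems.PointSinkSolitonTransplantStubSolitonCoreFamily

/-!
# Line `Sketch` (crux idea `mollifier-ladder-subsolution`) — crux `PointSink.SolitonTransplant`
(stmt-AnomalousDissipation-19035), lead skeleton v5

Lead: prover-line-stmt-AnomalousDissipation-19035-0, 2026-08-17. Rebuilt from the tree card
`Cruxes/SolitonTransplant/Ideas/mollifier-ladder-subsolution.md` (the planner's `Sketch.lean` lives only in
the evidence store, which is not mounted in the lead's jail).

THE CRUX. `SolitonTransplant ≡ (CascadeSoliton → PointSinkZerothLaw)` (`Iff.rfl`): a smooth steady unforced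
unit-viscosity Navier–Stokes solution `(Q, P)` on `ℝ³` with `∫_{B_R}|Q|² ≤ C R^{5/3}`, `0 < ∫|∇Q|² < ∞` and a
non-trivial discretely self-similar `L²`-far field `V` (`V(λx) = λ^{-2/3}V(x)`,
`λ^{-5k/3}∫_{λ^k<|x|<λ^{k+1}}|Q−V|² → 0`) transplants to the point-sink zeroth law `X` on `T³`.

THE LINE (card, re-cut of the birth skeleton). `SolitonTransplant ⇐ FarFieldPackage ∧
SinkSubsolutionCompletion ∧ RelativeSteadyRealisation`:
* FAR-FIELD PACKAGE (derivable from the hypothesis alone; stubs S1–S4 below, worker-sized, def-free): the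
  exact NS rescalings `Q_k(y) = (λ^k)^{2/3} Q(λ^k y)` (steady NS at viscosity `(λ^k)^{-1/3}`, zero force,
  `IsClassicalNSSolutionOn.stRescale`) converge to `V` in `L²_loc(ℝ³∖0)` (shell clause + DSS), so `V` is a
  PRESSURE-FREE WEAK STEADY EULER FIELD OFF THE ORIGIN and weakly divergence free (whole-space IBP,
  `WholeSpaceIBP.lean`, then `k → ∞`).
* FREE-SPACE SINK COMPLETION (stub S5a, XL−; v2): complete the cone `V` (amplitude `A = 1`) OUTSIDE the
  germ ball `B_{r₀}` by a smooth STRICT stationary Euler–Reynolds subsolution `(U∞, R∞ ≻ 0)` on `ℝ³` with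
  ZERO force which is AT REST `(0, c·Id)` outside `B_{r₁}`; the glued pair is a weak subsolution off the
  origin (card: mollified-cone ladder of layers `↓ ∂B_{r₀}`, compactly supported symmetric anti-divergence
  correctors — admissible because the critical DSS cone has zero momentum AND torque flux, LANDED as
  `Literature.Analysis.FluidPDE.DSSEulerCone.pairing_eq_zero` (p161086) —; the outward mass flux of `V`
  vanishes, so `U∞` can be cut off by a Bogovskiĭ corrector). Open analytic point: `Integrable R∞` needs
  `L¹`-control of the mollified pressures' differences on the layers (wave-1 worker, §3(iv) of
  work/stubs/StubSinkSubsolutionCompletion.lean).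
* TUNED TORUS PLANTING (stub S5b, L; v2): rescale the completion by `λ^{-m}` (DSS keeps the germ), plant it at
  a sink `x₀ ∈ T³`, and add a disjoint smooth STIRRING CELL `(W, R_W ≻ 0, f)` — a compactly supported strict
  subsolution cell in the ambient rest state with a smooth divergence-free compactly supported force `f` and
  PRESCRIBED POWER `∫⟪f, U⟫ = D := ∫|∇Q|²` (symmetric anti-divergence / double-divergence inverses with
  vanishing moments, tree `MaoOhTao.hasWeakSymmDivInverse_annulus`, `hasWeakDoubleDivInverse_annulus`).
  The power clause is what v1 lacked (wave-1 design flag: v1's scaffold was satisfiable with `f ≡ 0`,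
  making v1's realisation stub closable only if `CascadeSoliton` is empty).
* RELATIVE STEADY REALISATION (stub S6, XL, the lead's; v2 = v1 + the power hypothesis): along
  `ν_j = λ^{-j/3}` glue the exact family `ν_j μ_j Q(μ_j ·)`, `μ_j = ν_j^{-3} = λ^j`, into the scaffold and
  produce steady classical `NS_{ν_j}(f)` states on `T³` with bounded energy, dissipation floor (carried
  exactly by the core, `ν∫|∇u_ν|² = ∫|∇Q|² =` the scaffold's power) and point concentration at `x₀` — the
  conclusion is the body of `X` with `f`, `x₀` from the scaffold. This is the pointed/relative form of the
  open crux `SteadyWeakLimit.SteadyWeakRealisation` (stmt-AnomalousDissipation-1303/18056); no precedent in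
  print.

Registered stubs (def-free signatures; `theorem stub_<name> : … := by sorry`; the composition
`SolitonTransplant_of` concludes the route decl BY NAME with sorries only inside `stub_*`):
* `stub_shellDefectScaling` (S1, M) — DSS + the shell clause ⇒ `∫_{λ^a<|x|<λ^{a+1}}|Q_k − V|² → 0` for
  every INTEGER shell index `a` (change of variables `x ↦ λ^k x`, `Measure.addHaar_smul`; index shift).
* `stub_localL2Convergence` (S2, M) — integer-shell convergence ⇒ `∫_{a<|x|<b}|Q_k − V|² → 0` for all
  `0 < a < b` (finite cover by shells, spheres are null: `Measure.addHaar_sphere`).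
* `stub_testedRescaledNS` (S3, M) — for the rescalings `u = μ^{2/3}Q(μ·)` (`μ > 0`; steady NS at viscosity
  `μ^{-1/3}` by `IsClassicalNSSolutionOn.stRescale`): `∫⟪u, Dφ·u⟫ = −μ^{-1/3}∫⟪u, Δφ⟫` for smooth compactly
  supported divergence-free `φ`, and `∫⟪u, ∇θ⟫ = 0` (tree IBP: `integral_inner_convect_add_eq_zero`,
  `integral_inner_gradient_eq_neg_integral_mul_divergence`, `integral_inner_laplacian_add_eq_zero`).
* `stub_farFieldWeakEuler` (S4, M) — local `L²` convergence + the tested identities ⇒ `V` is pressure-free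
  weak steady Euler off `0` and weakly divergence free (Cauchy–Schwarz on `tsupport φ`, `ν_k → 0`).
* `stub_freeSpaceSinkCompletion` (S5a, XL−; v2) — the zero-force free-space completion at rest outside.
  OPEN; tools landed by wave 2: `WeaklyDivFreeRemovablePoint.lean` (p162492), `MollifiedEulerCone*.lean`
  (p163401, p164259, p164585: mollified cones are smooth unforced Euler–Reynolds subsolutions off `B_{4δ}`),
  `ExteriorDeRham.lean` (p163971); remaining: negative-order symmetric anti-divergence on thin shells,
  pressure-difference duality `W^{-1,r}`, smooth scalar Bogovskiĭ, ladder assembly.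
* `stub_tunedTorusPlanting` (S5b, L; v2) — completion + power target `D > 0` ⇒ torus scaffold with
  `∫⟪f, U⟫ = D`. LANDED p166256 (v3), with 8 Literature files (explicit stirring cell `StirringCell.lean`,
  `EulerReynoldsDilation/Localization/TorusPlanting*/TorusScaffold.lean`, `Torus/TorusPlantingTools.lean`).
* `stub_solitonCoreFamily` (S6b, M; v3) — the soliton's exact NS rescalings along `ν_j = (λ^j)^{-1/3}`: exact
  dissipation `ν_j∫|∇c_j|² = ∫|∇Q|²`, point concentration, `L²(B_{r₀})`-convergence to the cone. LANDED p168229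
  (v5: the skeleton points at `Theorems.stub_solitonCoreFamily`; open stubs are now S5a and S6a only).
* `stub_relativeRealisationDesign` (S6a, XL, HARDEST, the lead's; v4) — far-field cone + free-space completion + exact
  zero-force core family burning `D` at the sink ⇒ ∃ designed `f`, `x₀` and steady states realising the body of `X` (the
  open wall, soliton-free, ∃-design form; v3's ∀-scaffold `stub_relativeRealisationPrinciple` is EXPIRED — for the landed
  rest-gap scaffolds of S5b it was probably false-if-inhabited, census work/S6a-census.md point 5). In v4 the landed S5b
  is a consistency witness (the power-tuned scaffold class is non-empty), no longer a link of the chain.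
v1's `stub_sinkSubsolutionCompletion`, v1/v2's `stub_relativeSteadyRealisation` are
EXPIRED (v3 splits the latter into S6b provable + S6a the soliton-free principle) (wave-1 design flag, see above). S1–S4 are LANDED (p159340, p159343, p159254, p159417).

STATUS AT THE EXIT OF LEAD c1 (2026-08-17, `Lines/Sketch.dead.md`, `LeadAnalysisC1.md`): the line is declared DEAD —
S6a `stub_relativeRealisationDesign` is the pointed form of the open steady realisation problem (stmt-1303 / the target
itself: exact-core designs are rigid by unique continuation, inexact cores need steady small-viscosity stability, which the
line's `Leans on:` lists as open), and S5a `stub_freeSpaceSinkCompletion` is blocked at the `L¹` endpoint on singular-integral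
infrastructure (tools R1/R2 landed: `MaoOhTao.exists_smooth_divInverse_shell`, `exists_smooth_symmDivInverse_shell`,
`Literature.Analysis.FluidPDE.exists_smooth_symmStress_rowDivergence_eq_of_shell`). What survives as supports of the crux:
S1–S4, S5b, S6b, the negative lemmas `Negative/PointSinkEnergyFlux*.lean` (the floor must cross every shell around the
sink) and `PointSinkSolitonTransplantCoreEnergy{Identity,Flux}.lean` (the core family feeds the origin with flux `D`).
Recommended re-line: `Ideas/viscosity-ladder.md`.

Disproof.lean for this crux (v5, cdisprove cycle 1, 14:20Z): no kill possible structurally; six negative lemmas landed under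
`Theorems/SolitonTransplant/Negative/` (antecedent redundancy/envelope, weighted energy identity, no bounded / no
`L^q×L^{q/2}` (q > 9/2) point sink); §3 Targets: none on this line's stubs. (The v1 text below predates it.)
Disproof.lean at v1 time: none existed (payload `disproof_path` not mounted; `ledger crux ls`
2026-08-17T11:30Z shows no Disproof.lean). Honoured: `Theorems/SolitonTransplant/Negative/PointSinkTameNoGo.lean`
(p142855) — the scaffold of S5 contains the exact non-tame germ `V` and is a STRICT subsolution on the collar,
so no tame-limit hypothesis of `dissipationFloor_false_of_tame` can be met by what S6 converges to.
-/

noncomputable section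

-- `Summit.<Summit>.<Problem>`: single-conjunct summit, the duplicate namespace is mandated (CONVENTIONS §2).
set_option linter.dupNamespace false

namespace Summit.AnomalousDissipation.AnomalousDissipation.Cruxes.SolitonTransplant.Sketch

open MeasureTheory Filter Topology Set Metric
open scoped InnerProductSpace ContDiff Laplacian
open Literature.Analysis.FunctionSpaces
open Literature.Analysis.FluidPDE

/-- Physical space `ℝ³`. -/
local notation "E³" => EuclideanSpace ℝ (Fin 3)
/-- The flat three-torus. -/
local notation "𝕋³" => UnitAddTorus (Fin 3)

/-! ## Registered stubs — the far-field package (derivable) -/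

/-- **S1 `stub_shellDefectScaling` (M; provable now).** For a discretely self-similar far field
`V(λx) = λ^{-2/3}V(x)` (`x ≠ 0`, `λ > 1`) and the rescalings `Q_k(x) = (λ^k)^{2/3} Q(λ^k x)`, the change
of variables `x ↦ λ^k x` gives, for every integer shell index `a` and `k ≥ -a`,
`∫_{λ^a<|x|<λ^{a+1}} |Q_k − V|² = λ^{5a/3} · (λ^{a+k})^{-5/3} ∫_{λ^{a+k}<|x|<λ^{a+k+1}} |Q − V|²`, so the
shell clause of `CascadeSoliton` transports to every integer shell: the left side tends to `0` as
`k → ∞`. Tools: `MeasureTheory.Measure.integral_comp_smul` / `setIntegral` under `x ↦ λ^k • x`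
(`Measure.addHaar_smul`, `finrank = 3`), `V(λ^k x) = (λ^k)^{-2/3} V(x)` by induction, `zpow_natCast`,
`Filter.tendsto_add_atTop_iff_nat`. [folklore] -/
theorem stub_shellDefectScaling :
    ∀ (Q V : E³ → E³) (lam : ℝ), 1 < lam →
      (∀ x : E³, x ≠ 0 → V (lam • x) = lam ^ (-(2 / 3 : ℝ)) • V x) →
      Tendsto (fun k : ℕ => (lam ^ k) ^ (-(5 / 3 : ℝ)) *
        ∫ x in {x : E³ | lam ^ k < ‖x‖ ∧ ‖x‖ < lam ^ (k + 1)}, ‖Q x - V x‖ ^ 2) atTop (𝓝 0) →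
      ∀ a : ℤ, Tendsto (fun k : ℕ =>
        ∫ x in {x : E³ | lam ^ a < ‖x‖ ∧ ‖x‖ < lam ^ (a + 1)},
          ‖(lam ^ k) ^ (2 / 3 : ℝ) • Q (lam ^ k • x) - V x‖ ^ 2) atTop (𝓝 0) :=
  -- LANDED: Theorems/PointSinkSolitonTransplantStubShellDefectScaling.lean (p159340, accepted 2026-08-17)
  Summit.AnomalousDissipation.AnomalousDissipation.Theorems.stub_shellDefectScaling

/-- **S2 `stub_localL2Convergence` (M; provable now).** Integer-shell convergence of the rescalings
`Q_k = (λ^k)^{2/3}Q(λ^k ·)` to `V` upgrades to `L²` convergence on every fixed annulus `a < |x| < b`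
(`0 < a < b`): cover `[a, b]` by finitely many shells `λ^i ≤ |x| ≤ λ^{i+1}`, `-m ≤ i < m`, the spheres
`|x| = λ^i` being Lebesgue-null (`Measure.addHaar_sphere`), and squeeze (the integrand is nonnegative and
integrable on the annulus: `Q` continuous, `V ∈ L²_loc(ℝ³∖0)` strongly measurable). [folklore] -/
theorem stub_localL2Convergence :
    ∀ (Q V : E³ → E³) (lam : ℝ), 1 < lam → Continuous Q →
      AEStronglyMeasurable V volume →
      LocallyIntegrableOn (fun x => ‖V x‖ ^ 2) {x : E³ | x ≠ 0} volume →
      (∀ a : ℤ, Tendsto (fun k : ℕ =>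
        ∫ x in {x : E³ | lam ^ a < ‖x‖ ∧ ‖x‖ < lam ^ (a + 1)},
          ‖(lam ^ k) ^ (2 / 3 : ℝ) • Q (lam ^ k • x) - V x‖ ^ 2) atTop (𝓝 0)) →
      ∀ a b : ℝ, 0 < a → a < b → Tendsto (fun k : ℕ =>
        ∫ x in {x : E³ | a < ‖x‖ ∧ ‖x‖ < b},
          ‖(lam ^ k) ^ (2 / 3 : ℝ) • Q (lam ^ k • x) - V x‖ ^ 2) atTop (𝓝 0) :=
  -- LANDED: Theorems/PointSinkSolitonTransplantStubLocalL2Convergence.lean (p159343, accepted 2026-08-17)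
  Summit.AnomalousDissipation.AnomalousDissipation.Theorems.stub_localL2Convergence

/-- **S3 `stub_testedRescaledNS` (M; provable now).** For a smooth steady solution `(Q, P)` of
unit-viscosity unforced Navier–Stokes on `ℝ³` and `μ > 0`, the rescaling `u(x) = μ^{2/3} Q(μ x)`,
`p(x) = μ^{4/3} P(μ x)` is a smooth steady solution at viscosity `μ^{-1/3}` with zero force
(`IsClassicalNSSolutionOn.stRescale` with `α = μ^{2/3}`, `γ = μ`), hence satisfies the TESTED identities:
`∫ ⟪u, Dφ·u⟫ = −μ^{-1/3} ∫ ⟪u, Δφ⟫` for every smooth compactly supported divergence-free `φ` (convective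
term by `integral_inner_convect_add_eq_zero` with `div u = 0`, pressure by
`integral_inner_gradient_eq_neg_integral_mul_divergence` with `div φ = 0`, viscous term by
`integral_inner_laplacian_add_eq_zero` twice), and `∫ ⟪u, ∇θ⟫ = 0` for every smooth compactly supported
`θ` (`integral_mul_divergence_add_eq_zero_left`). [folklore] -/
theorem stub_testedRescaledNS :
    ∀ (Q : E³ → E³) (P : E³ → ℝ),
      IsClassicalNSSolutionOn Set.univ 1 (fun _ _ => 0) (fun _ => Q) (fun _ => P) →
      ∀ μ : ℝ, 0 < μ →
        (∀ φ : E³ → E³, ContDiff ℝ ∞ φ → HasCompactSupport φ →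
          (∀ x, VectorCalculus.divergence φ x = 0) →
          ∫ x, ⟪μ ^ (2 / 3 : ℝ) • Q (μ • x), fderiv ℝ φ x (μ ^ (2 / 3 : ℝ) • Q (μ • x))⟫_ℝ =
            -(μ ^ (-(1 / 3 : ℝ))) * ∫ x, ⟪μ ^ (2 / 3 : ℝ) • Q (μ • x), (Δ φ) x⟫_ℝ) ∧
        (∀ θ : E³ → ℝ, ContDiff ℝ ∞ θ → HasCompactSupport θ →
          ∫ x, ⟪μ ^ (2 / 3 : ℝ) • Q (μ • x), gradient θ x⟫_ℝ = 0) :=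
  -- LANDED: Theorems/PointSinkSolitonTransplantStubTestedRescaledNS.lean (p159254, accepted 2026-08-17)
  Summit.AnomalousDissipation.AnomalousDissipation.Theorems.stub_testedRescaledNS

/-- **S4 `stub_farFieldWeakEuler` (M; provable now).** Passage to the limit `k → ∞` in the tested
identities of the rescalings `Q_k = (λ^k)^{2/3}Q(λ^k ·)` (viscosity `ν_k = (λ^k)^{-1/3} → 0`): for a
test field `φ` with `tsupport φ ⊆ {a < |x| < b} ⋐ ℝ³∖0`, `∫⟪Q_k, Dφ·Q_k⟫ → ∫⟪V, Dφ·V⟫` by Cauchy–Schwarz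
on the annulus (`Q_k → V` in `L²(a<|x|<b)`, `‖Q_k‖_{L²(a<|x|<b)}` bounded, `Dφ` bounded) while
`ν_k ∫⟪Q_k, Δφ⟫ → 0`; likewise `0 = ∫⟪Q_k, ∇θ⟫ → ∫⟪V, ∇θ⟫`. Conclusion: `V` is a PRESSURE-FREE weak
steady Euler field off the origin and weakly divergence free there (architecture note A2 of the crux's
BarrierNotes: the one upgrade of the far field that the hypothesis yields). [folklore] -/
theorem stub_farFieldWeakEuler :
    ∀ (Q V : E³ → E³) (lam : ℝ), 1 < lam → Continuous Q →
      AEStronglyMeasurable V volume →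
      LocallyIntegrableOn (fun x => ‖V x‖ ^ 2) {x : E³ | x ≠ 0} volume →
      (∀ a b : ℝ, 0 < a → a < b → Tendsto (fun k : ℕ =>
        ∫ x in {x : E³ | a < ‖x‖ ∧ ‖x‖ < b},
          ‖(lam ^ k) ^ (2 / 3 : ℝ) • Q (lam ^ k • x) - V x‖ ^ 2) atTop (𝓝 0)) →
      (∀ (k : ℕ) (φ : E³ → E³), ContDiff ℝ ∞ φ → HasCompactSupport φ →
        (∀ x, VectorCalculus.divergence φ x = 0) →
        ∫ x, ⟪(lam ^ k) ^ (2 / 3 : ℝ) • Q (lam ^ k • x),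
            fderiv ℝ φ x ((lam ^ k) ^ (2 / 3 : ℝ) • Q (lam ^ k • x))⟫_ℝ =
          -((lam ^ k) ^ (-(1 / 3 : ℝ))) *
            ∫ x, ⟪(lam ^ k) ^ (2 / 3 : ℝ) • Q (lam ^ k • x), (Δ φ) x⟫_ℝ) →
      (∀ (k : ℕ) (θ : E³ → ℝ), ContDiff ℝ ∞ θ → HasCompactSupport θ →
        ∫ x, ⟪(lam ^ k) ^ (2 / 3 : ℝ) • Q (lam ^ k • x), gradient θ x⟫_ℝ = 0) →
      (∀ φ : E³ → E³, IsTestFunctionOn ⟨{x : E³ | x ≠ 0}, isOpen_ne⟩ φ →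
        (∀ x, VectorCalculus.divergence φ x = 0) →
        ∫ x, ⟪V x, fderiv ℝ φ x (V x)⟫_ℝ = 0) ∧
      (∀ θ : E³ → ℝ, IsTestFunctionOn ⟨{x : E³ | x ≠ 0}, isOpen_ne⟩ θ →
        ∫ x, ⟪V x, gradient θ x⟫_ℝ = 0) :=
  -- LANDED: Theorems/PointSinkSolitonTransplantStubFarFieldWeakEuler.lean (p159417, accepted 2026-08-17)
  Summit.AnomalousDissipation.AnomalousDissipation.Theorems.stub_farFieldWeakEuler

/-! ## Registered stubs — the constructive steps (v2) -/

/-- **S5a `stub_freeSpaceSinkCompletion` (XL−; v2; the card's lever in free space).** ZERO-FORCE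
FREE-SPACE SINK COMPLETION of an arbitrary `L²` far-field cone. Input: `λ > 1` and a measurable `V`, DSS of
degree `−2/3`, `|V|²` locally integrable off `0`, non-trivial on the fundamental shell, pressure-free weak
steady Euler off `0`, weakly divergence free off `0`. Output, on `ℝ³`: radii `0 < r₀ < r₁`, an ambient
pressure level `c > 0`, a velocity `U ∈ L²(ℝ³)` EQUAL TO THE CONE on the punctured germ ball `0 < |x| < r₀`,
ZERO for `|x| ≥ r₁`, smooth on `{|x| > r₀}`, weakly divergence free on all of `ℝ³` (the sink is a removable
point for `L²` fields); a real `3×3` Reynolds stress `R`, zero on the closed germ ball, equal to `c·Id` for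
`|x| ≥ r₁`, integrable on `B_{r₁}`, smooth and POSITIVE DEFINITE on `{|x| > r₀}`; and the glued pair is a
weak stationary Euler–Reynolds subsolution WITHOUT force off the origin:
`∫ (⟪U, DU·w… ⟫)` — precisely `∫ (⟪U, Dw·U⟫ + R : ∇w) = 0` for every smooth divergence-free `w` compactly
supported in `ℝ³∖{0}` (`(∇w)ᵢⱼ = ∂ⱼwᵢ = (Dw eⱼ)ᵢ`). Intended proof (wave-1 worker's architecture, §3 of
work/stubs/StubSinkSubsolutionCompletion.lean): translation-mollified cones `(ρ_δ ⋆ V, ρ_δ ⋆ (V⊗V))` are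
exact smooth LINEAR subsolutions off `B_δ` with PSD defect (Jensen); de Rham on shells for their smooth
pressures; dyadic ladder of layers accumulating at `|x| = r₀` from outside; layer mismatches absorbed by
compactly supported symmetric anti-divergence (zero momentum AND torque flux of the critical DSS cone:
`Literature.Analysis.FluidPDE.DSSEulerCone.pairing_eq_zero`, LANDED p161086) and scalar Bogovskiĭ (zero mass
flux); outside `B_{r₁}` cut off to rest, the defect topped up by `c·Id`; strictness is free (`+ ε(x)·Id`).
Open analytic point (why it might fail): `IntegrableOn R (B_{r₁})` needs `L¹`-control of the differences of
the mollified pressures on the layers, which `V ∈ L²_loc` alone may not give (the would-be pressure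
`RᵢRⱼ(VᵢVⱼ)` of `V` is only weak-`L¹`). Print: De Lellis–Székelyhidi 2010/2012 (subsolutions), Isett–Oh
arXiv:1402.2305 and Mao–Oh–Tao 2023 Lemma 2.2 (anti-divergence; tree `MaoOhTao.hasWeakSymmDivInverse_annulus`). [folklore] -/
theorem stub_freeSpaceSinkCompletion :
    ∀ (lam : ℝ) (V : E³ → E³), 1 < lam → AEStronglyMeasurable V volume →
      (∀ x : E³, x ≠ 0 → V (lam • x) = lam ^ (-(2 / 3 : ℝ)) • V x) →
      LocallyIntegrableOn (fun x => ‖V x‖ ^ 2) {x : E³ | x ≠ 0} volume →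
      0 < ∫ x in {x : E³ | 1 < ‖x‖ ∧ ‖x‖ < lam}, ‖V x‖ ^ 2 →
      (∀ φ : E³ → E³, IsTestFunctionOn ⟨{x : E³ | x ≠ 0}, isOpen_ne⟩ φ →
        (∀ x, VectorCalculus.divergence φ x = 0) →
        ∫ x, ⟪V x, fderiv ℝ φ x (V x)⟫_ℝ = 0) →
      (∀ θ : E³ → ℝ, IsTestFunctionOn ⟨{x : E³ | x ≠ 0}, isOpen_ne⟩ θ →
        ∫ x, ⟪V x, gradient θ x⟫_ℝ = 0) →
      ∃ (r₀ r₁ c : ℝ) (U : E³ → E³) (R : E³ → Fin 3 → Fin 3 → ℝ),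
        (0 < r₀ ∧ r₀ < r₁ ∧ 0 < c) ∧
        (∀ x : E³, 0 < ‖x‖ → ‖x‖ < r₀ → U x = V x) ∧
        (∀ x : E³, ‖x‖ ≤ r₀ → R x = 0) ∧
        (∀ x : E³, r₁ ≤ ‖x‖ → U x = 0 ∧ R x = fun i j => if i = j then c else 0) ∧
        ContDiffOn ℝ ∞ U {x : E³ | r₀ < ‖x‖} ∧ ContDiffOn ℝ ∞ R {x : E³ | r₀ < ‖x‖} ∧
        (∀ x : E³, r₀ < ‖x‖ → (Matrix.of (R x)).PosDef) ∧
        (MemLp U 2 volume ∧ IntegrableOn R (ball (0 : E³) r₁) volume) ∧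
        (∀ θ : E³ → ℝ, ContDiff ℝ ∞ θ → HasCompactSupport θ → ∫ x, ⟪U x, gradient θ x⟫_ℝ = 0) ∧
        (∀ w : E³ → E³, IsTestFunctionOn ⟨{x : E³ | x ≠ 0}, isOpen_ne⟩ w →
          (∀ x, VectorCalculus.divergence w x = 0) →
          ∫ x, (⟪U x, fderiv ℝ w x (U x)⟫_ℝ +
            ∑ i, ∑ j, R x i j * fderiv ℝ w x (EuclideanSpace.single j 1) i) = 0) := by
  sorry

/-- **S5b `stub_tunedTorusPlanting` (L; v2).** TUNED TORUS PLANTING: from a free-space sink completion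
`(r₀, r₁, c, U∞, R∞)` of the DSS cone `V` (the clauses of `stub_freeSpaceSinkCompletion`) and a power
target `D > 0`, build the torus SCAFFOLD of the line with PRESCRIBED POWER `∫⟪f, U⟫ = D`: rescale the
completion by `λ^{-m}` (`x ↦ λ^{2m/3}U∞(λ^m x)`, `λ^{4m/3}R∞(λ^m x)`; the germ is unchanged by DSS, the radii
shrink below `1/8`, the ambient level grows like `λ^{4m/3}`), plant it at a sink `x₀ ∈ T³` in the chart
`v ↦ x₀ + proj v` (`Torus.liftAt · x₀`; the outer set `{v | ∀ w, proj w = 0 → r₀ < ‖v − w‖}` = chart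
points farther than `r₀` from the lattice `ℤ³`), and add, in a disjoint ball of the fundamental cube, a
smooth compactly supported STIRRING CELL `(W, R_W ≻ 0)` in the ambient rest state `(0, c'·Id)` with a smooth
divergence-free compactly supported force `f` and power `∫⟪f, W⟫ = −∫ R_W : ∇W = D` (design: `W ∈ C_c^∞`
divergence free; `R_W = c'Id + S + S₀` with `∂ᵢ∂ⱼSⁱʲ = −∂ᵢWⱼ∂ⱼWᵢ` (double-divergence inverse, zero
affine moments) so that `f := div(W⊗W + S + S₀)` is divergence free and compactly supported, and `S₀` a
symmetric anti-divergence of a curl tuned to the vorticity of `W` to set the power; tree tools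
`MaoOhTao.hasWeakDoubleDivInverse_annulus`, `hasWeakSymmDivInverse_annulus` + regularity). Output clauses =
v1's scaffold (radii `0 < r₀' < r₁' ≤ 1/4`; `f` smooth, divergence free, mean zero, `≡ 0` on `B_{r₁'}(x₀)`;
`U = V` on the punctured germ ball; `R = 0` on the closed germ ball; `U`, `R` smooth and `R ≻ 0` on the outer
set; `U ∈ L²(T³)`, `R ∈ L¹`, `U` weakly divergence free; weak Euler–Reynolds subsolution with source `f`
off the sink) PLUS the power clause. Torus transfer: `FlatTorusProofs` (`integral_eq_integral_lift_holds`,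
`lift_descend_holds`). [folklore] -/
theorem stub_tunedTorusPlanting :
    ∀ (lam : ℝ) (V : E³ → E³), 1 < lam →
      (∀ x : E³, x ≠ 0 → V (lam • x) = lam ^ (-(2 / 3 : ℝ)) • V x) →
      ∀ (r₀ r₁ c : ℝ) (U : E³ → E³) (R : E³ → Fin 3 → Fin 3 → ℝ),
        (0 < r₀ ∧ r₀ < r₁ ∧ 0 < c) →
        (∀ x : E³, 0 < ‖x‖ → ‖x‖ < r₀ → U x = V x) →
        (∀ x : E³, ‖x‖ ≤ r₀ → R x = 0) →
        (∀ x : E³, r₁ ≤ ‖x‖ → U x = 0 ∧ R x = fun i j => if i = j then c else 0) →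
        ContDiffOn ℝ ∞ U {x : E³ | r₀ < ‖x‖} → ContDiffOn ℝ ∞ R {x : E³ | r₀ < ‖x‖} →
        (∀ x : E³, r₀ < ‖x‖ → (Matrix.of (R x)).PosDef) →
        (MemLp U 2 volume ∧ IntegrableOn R (ball (0 : E³) r₁) volume) →
        (∀ θ : E³ → ℝ, ContDiff ℝ ∞ θ → HasCompactSupport θ → ∫ x, ⟪U x, gradient θ x⟫_ℝ = 0) →
        (∀ w : E³ → E³, IsTestFunctionOn ⟨{x : E³ | x ≠ 0}, isOpen_ne⟩ w →
          (∀ x, VectorCalculus.divergence w x = 0) →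
          ∫ x, (⟪U x, fderiv ℝ w x (U x)⟫_ℝ +
            ∑ i, ∑ j, R x i j * fderiv ℝ w x (EuclideanSpace.single j 1) i) = 0) →
      ∀ D : ℝ, 0 < D →
      ∃ (x₀ : 𝕋³) (r₀' r₁' : ℝ) (f U' : 𝕋³ → E³) (R' : 𝕋³ → Fin 3 → Fin 3 → ℝ),
        (0 < r₀' ∧ r₀' < r₁' ∧ r₁' ≤ 1 / 4) ∧
        (Torus.IsSmooth f ∧ Torus.IsDivFree f ∧ Torus.HasZeroMean f) ∧
        (∀ v : E³, ‖v‖ < r₁' → Torus.liftAt f x₀ v = 0) ∧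
        (∀ v : E³, 0 < ‖v‖ → ‖v‖ < r₀' → Torus.liftAt U' x₀ v = V v) ∧
        (∀ v : E³, ‖v‖ ≤ r₀' → Torus.liftAt R' x₀ v = 0) ∧
        ContDiffOn ℝ ∞ (Torus.liftAt U' x₀) {v : E³ | ∀ w : E³, Torus.proj w = 0 → r₀' < ‖v - w‖} ∧
        ContDiffOn ℝ ∞ (Torus.liftAt R' x₀) {v : E³ | ∀ w : E³, Torus.proj w = 0 → r₀' < ‖v - w‖} ∧
        (∀ v : E³, (∀ w : E³, Torus.proj w = 0 → r₀' < ‖v - w‖) →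
          (Matrix.of (Torus.liftAt R' x₀ v)).PosDef) ∧
        (MemLp U' 2 volume ∧ Integrable R' volume ∧ Torus.IsWeaklyDivFree U') ∧
        (∀ w : 𝕋³ → E³, Torus.IsSmooth w → Torus.IsDivFree w →
          (∃ δ : ℝ, 0 < δ ∧ ∀ v : E³, ‖v‖ < δ → Torus.liftAt w x₀ v = 0) →
          ∫ x, (⟪U' x, Torus.convect U' w x⟫_ℝ +
            ∑ i, ∑ j, R' x i j * Torus.partialDeriv j w x i + ⟪f x, w x⟫_ℝ) = 0) ∧
        ∫ x, ⟪f x, U' x⟫_ℝ = D :=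
  -- LANDED: Theorems/PointSinkSolitonTransplantStubTunedTorusPlanting.lean (p166256, accepted 2026-08-17T14:28Z)
  Summit.AnomalousDissipation.AnomalousDissipation.Theorems.stub_tunedTorusPlanting

/-- **S6b `stub_solitonCoreFamily` (M; v3; provable now).** THE EXACT CORE FAMILY of a cascade soliton.
Along `ν_j := (λ^j)^{-1/3}` the exact NS rescalings `c_j(y) := (λ^j)^{2/3} Q(λ^j y)`, `π_j(y) := (λ^j)^{4/3} P(λ^j y)`
(the same family as in S1–S4; `c_j = ν_j μ_j Q(μ_j ·)` with `μ_j = ν_j^{-3} = λ^j`) are smooth steady solutions of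
zero-force `NS_{ν_j}` on `ℝ³` (`IsClassicalNSSolutionOn.stRescale`), with (i) `ν_j > 0`, `ν_j → 0`; (ii) integrable
`|∇c_j|²` and the EXACT dissipation identity `ν_j ∫|∇c_j|² = ∫|∇Q|²` (free-space zeroth law: `∇c_j(y) =
(λ^j)^{5/3}(∇Q)(λ^j y)`, change of variables; cf. route support `FreeSpaceZerothLaw`, stmt-19037); (iii) point
concentration `ν_j ∫_{|y| ≥ r}|∇c_j|² = ∫_{|x| ≥ λ^j r}|∇Q|² → 0` (integrable tail); (iv) `L²`-convergence to the
cone on every BALL `B_{r₀}`: on annuli by the landed S1/S2, near the centre by the mass envelope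
`∫_{B_r}|c_j|² ≤ C r^{5/3}` (`λ^j r ≥ 1`) and its DSS counterpart for `V` (`DSSCone.normSq_integrableOn_ball`).
[folklore] -/
theorem stub_solitonCoreFamily :
    ∀ (Q : E³ → E³) (P : E³ → ℝ),
      IsClassicalNSSolutionOn Set.univ 1 (fun _ _ => 0) (fun _ => Q) (fun _ => P) →
      (∃ C : ℝ, ∀ R : ℝ, 1 ≤ R → ∫ x in ball (0 : E³) R, ‖Q x‖ ^ 2 ≤ C * R ^ (5 / 3 : ℝ)) →
      Integrable (fun x => frobeniusNormSq (fderiv ℝ Q x)) →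
      ∀ (lam : ℝ) (V : E³ → E³), 1 < lam → AEStronglyMeasurable V volume →
      (∀ x : E³, x ≠ 0 → V (lam • x) = lam ^ (-(2 / 3 : ℝ)) • V x) →
      LocallyIntegrableOn (fun x => ‖V x‖ ^ 2) {x : E³ | x ≠ 0} volume →
      Tendsto (fun k : ℕ => (lam ^ k) ^ (-(5 / 3 : ℝ)) *
        ∫ x in {x : E³ | lam ^ k < ‖x‖ ∧ ‖x‖ < lam ^ (k + 1)}, ‖Q x - V x‖ ^ 2) atTop (𝓝 0) →
      (∀ j : ℕ, 0 < (lam ^ j) ^ (-(1 / 3 : ℝ))) ∧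
      Tendsto (fun j : ℕ => (lam ^ j) ^ (-(1 / 3 : ℝ))) atTop (𝓝 0) ∧
      (∀ j : ℕ, IsClassicalNSSolutionOn Set.univ ((lam ^ j) ^ (-(1 / 3 : ℝ))) (fun _ _ => 0)
        (fun _ y => (lam ^ j) ^ (2 / 3 : ℝ) • Q (lam ^ j • y))
        (fun _ y => (lam ^ j) ^ (4 / 3 : ℝ) * P (lam ^ j • y))) ∧
      (∀ j : ℕ, Integrable (fun y =>
        frobeniusNormSq (fderiv ℝ (fun y => (lam ^ j) ^ (2 / 3 : ℝ) • Q (lam ^ j • y)) y))) ∧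
      (∀ j : ℕ, (lam ^ j) ^ (-(1 / 3 : ℝ)) *
          ∫ y, frobeniusNormSq (fderiv ℝ (fun y => (lam ^ j) ^ (2 / 3 : ℝ) • Q (lam ^ j • y)) y) =
        ∫ x, frobeniusNormSq (fderiv ℝ Q x)) ∧
      (∀ r : ℝ, 0 < r → Tendsto (fun j : ℕ => (lam ^ j) ^ (-(1 / 3 : ℝ)) *
        ∫ y in {y : E³ | r ≤ ‖y‖},
          frobeniusNormSq (fderiv ℝ (fun y => (lam ^ j) ^ (2 / 3 : ℝ) • Q (lam ^ j • y)) y))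
        atTop (𝓝 0)) ∧
      (∀ r₀ : ℝ, 0 < r₀ → Tendsto (fun j : ℕ =>
        ∫ y in ball (0 : E³) r₀, ‖(lam ^ j) ^ (2 / 3 : ℝ) • Q (lam ^ j • y) - V y‖ ^ 2) atTop (𝓝 0)) :=
  -- LANDED: Theorems/PointSinkSolitonTransplantStubSolitonCoreFamily.lean (p168229, accepted 2026-08-17T16:00Z)
  Summit.AnomalousDissipation.AnomalousDissipation.Theorems.stub_solitonCoreFamily

/-- **S6a `stub_relativeRealisationDesign` (XL / open-problem class; HARDEST; the lead's; v4).** THE RELATIVE STEADY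
REALISATION, DESIGN FORM — the open content of the line, isolated from solitons, with the design freedom where the
difficulty is. DATA: (i) the far-field cone `V` (DSS of degree `−2/3`, `|V|² ∈ L¹_loc` off `0`, non-trivial,
pressure-free weak steady Euler and weakly divergence free off `0` — the landed far-field package); (ii) a ZERO-FORCE
FREE-SPACE SINK COMPLETION `(r₀, r₁, c, U, R)` of `V` (the clauses of `stub_freeSpaceSinkCompletion`: exact germ `V` on
the punctured ball `B_{r₀}`, smooth strict Euler–Reynolds subsolution on `{|x| > r₀}`, at rest `(0, c·Id)` outside
`B_{r₁}`, `U ∈ L²`, `R ∈ L¹(B_{r₁})`, weakly divergence free, weak subsolution identity off `0`); (iii) a power level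
`D > 0` and an EXACT CORE FAMILY: `ν_j → 0⁺`, smooth steady zero-force `NS_{ν_j}` solutions `(c_j, π_j)` on `ℝ³` with
`ν_j∫|∇c_j|² = D` exactly, point concentration `ν_j∫_{|y|≥r}|∇c_j|² → 0`, and `c_j → V` in `L²` of EVERY ball (the landed
`stub_solitonCoreFamily`). CLAIM: one can DESIGN a smooth divergence-free mean-zero force `f` on `T³` and a sink `x₀` such
that steady classical `NS_{ν'_j}(f)` states exist along some `ν'_j → 0⁺` with `∫|u_j|² ≤ E`, `ν'_j‖∇u_j‖² ≥ ε > 0` and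
`ν'_j ∫_{dist(x,x₀) ≥ r} Σ_i|∂_i u_j|² → 0` for every `r > 0` — i.e. `PointSinkZerothLaw`'s body. ONE admissible design
class is landed: `stub_tunedTorusPlanting` (rescaled completion planted at `x₀`, a disjoint explicit stirring cell of
prescribed power `∫⟪f, U'⟫ = D`, rest state in between) — but for that class the injected power would have to cross a
region where the states converge weakly to rest (lead census work/S6a-census.md, point 5); the intended design (card)
connects the stirring to the sink by a mean FEEDING flow glued to the completion's smooth collar, and realises the strict
subsolution scaffold WEAKLY (`u_j ⊗ u_j ⇀ U ⊗ U + R`) around the exact core `c_j(· − x₀)`, whose dissipation `D` the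
force pays for through the steady energy identity `ν‖∇u‖² = ∫⟪f, u⟫` (tree: `CoherentStates.steady_energy_identity`).
STATUS: open. Inhabiting (iii) is Galdi's Liouville problem (so the stub is refutation-immune exactly like the crux);
the realisation technology it needs contains that of the open crux `SteadyWeakLimit.SteadyWeakRealisation`
(stmt-AnomalousDissipation-1303: steady vanishing-viscosity realisation of a strict stationary subsolution with positive
power at fixed `f`, BCCDS2024 Open Q1 in elliptic form) plus point concentration; no theorem in print realises steady NS
states near a strict steady subsolution or a rough steady Euler field as `ν → 0`. Why it might fail: recurrence on `T³`
(BarrierNotes A4/B4), laminarisation of steady branches at fixed `f` (`εℓ/U³ ∼ Re⁻¹`), non-Fredholm linearised steady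
Euler operator outside, and `sup|u_j| → ∞` is forced (Disproof.lean §2). v3's ∀-scaffold form
`stub_relativeRealisationPrinciple` is EXPIRED in favour of this ∃-design form. [folklore] -/
theorem stub_relativeRealisationDesign :
    ∀ (lam : ℝ) (V : E³ → E³), 1 < lam → AEStronglyMeasurable V volume →
      (∀ x : E³, x ≠ 0 → V (lam • x) = lam ^ (-(2 / 3 : ℝ)) • V x) →
      LocallyIntegrableOn (fun x => ‖V x‖ ^ 2) {x : E³ | x ≠ 0} volume →
      0 < ∫ x in {x : E³ | 1 < ‖x‖ ∧ ‖x‖ < lam}, ‖V x‖ ^ 2 →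
      (∀ φ : E³ → E³, IsTestFunctionOn ⟨{x : E³ | x ≠ 0}, isOpen_ne⟩ φ →
        (∀ x, VectorCalculus.divergence φ x = 0) →
        ∫ x, ⟪V x, fderiv ℝ φ x (V x)⟫_ℝ = 0) →
      (∀ θ : E³ → ℝ, IsTestFunctionOn ⟨{x : E³ | x ≠ 0}, isOpen_ne⟩ θ →
        ∫ x, ⟪V x, gradient θ x⟫_ℝ = 0) →
      ∀ (r₀ r₁ c : ℝ) (U : E³ → E³) (R : E³ → Fin 3 → Fin 3 → ℝ),
        (0 < r₀ ∧ r₀ < r₁ ∧ 0 < c) →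
        (∀ x : E³, 0 < ‖x‖ → ‖x‖ < r₀ → U x = V x) →
        (∀ x : E³, ‖x‖ ≤ r₀ → R x = 0) →
        (∀ x : E³, r₁ ≤ ‖x‖ → U x = 0 ∧ R x = fun i j => if i = j then c else 0) →
        ContDiffOn ℝ ∞ U {x : E³ | r₀ < ‖x‖} → ContDiffOn ℝ ∞ R {x : E³ | r₀ < ‖x‖} →
        (∀ x : E³, r₀ < ‖x‖ → (Matrix.of (R x)).PosDef) →
        (MemLp U 2 volume ∧ IntegrableOn R (ball (0 : E³) r₁) volume) →
        (∀ θ : E³ → ℝ, ContDiff ℝ ∞ θ → HasCompactSupport θ → ∫ x, ⟪U x, gradient θ x⟫_ℝ = 0) →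
        (∀ w : E³ → E³, IsTestFunctionOn ⟨{x : E³ | x ≠ 0}, isOpen_ne⟩ w →
          (∀ x, VectorCalculus.divergence w x = 0) →
          ∫ x, (⟪U x, fderiv ℝ w x (U x)⟫_ℝ +
            ∑ i, ∑ j, R x i j * fderiv ℝ w x (EuclideanSpace.single j 1) i) = 0) →
      ∀ D : ℝ, 0 < D →
      ∀ (ν : ℕ → ℝ) (cr : ℕ → E³ → E³) (π : ℕ → E³ → ℝ),
        (∀ j, 0 < ν j) → Tendsto ν atTop (𝓝 0) →
        (∀ j, IsClassicalNSSolutionOn Set.univ (ν j) (fun _ _ => 0) (fun _ => cr j) (fun _ => π j)) →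
        (∀ j, Integrable (fun y => frobeniusNormSq (fderiv ℝ (cr j) y))) →
        (∀ j, ν j * ∫ y, frobeniusNormSq (fderiv ℝ (cr j) y) = D) →
        (∀ r : ℝ, 0 < r → Tendsto (fun j => ν j *
          ∫ y in {y : E³ | r ≤ ‖y‖}, frobeniusNormSq (fderiv ℝ (cr j) y)) atTop (𝓝 0)) →
        (∀ r : ℝ, 0 < r → Tendsto (fun j => ∫ y in ball (0 : E³) r, ‖cr j y - V y‖ ^ 2) atTop (𝓝 0)) →
        ∃ (f : 𝕋³ → E³) (x₀ : 𝕋³) (ν' : ℕ → ℝ) (u : ℕ → 𝕋³ → E³) (p : ℕ → 𝕋³ → ℝ),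
          Torus.IsSmooth f ∧ Torus.IsDivFree f ∧ Torus.HasZeroMean f ∧
          (∀ j, 0 < ν' j) ∧ Tendsto ν' atTop (𝓝 0) ∧
          (∀ j, Torus.IsClassicalNSSolutionOn Set.univ (ν' j) (fun _ => f) (fun _ => u j)
            (fun _ => p j)) ∧
          (∃ E : ℝ, ∀ j, ∫ x, ‖u j x‖ ^ 2 ≤ E) ∧
          (∃ ε : ℝ, 0 < ε ∧ ∀ j, ε ≤ ν' j * Torus.gradNormSq (u j)) ∧
          ∀ r : ℝ, 0 < r → Tendsto (fun j => ν' j *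
            ∫ x in {x : 𝕋³ | r ≤ dist x x₀}, ∑ i, ‖Torus.partialDeriv i (u j) x‖ ^ 2)
            atTop (𝓝 0) := by
  sorry

/-! ## The composition -/

/-- **The line closes the crux modulo its stubs.** From a cascade soliton: transport the shell clause to
integer shells (S1), get `L²_loc(ℝ³∖0)` convergence of the rescalings (S2), test the rescaled steady NS
equations (S3), pass to the limit (S4: `V` is a pressure-free weak Euler cone), complete the sink (S5a/S5b),
rescale the soliton into its exact core family (S6b), realise steadily (S6a), and read off `PointSinkZerothLaw`. (v2: S5 = S5a free-space completion +
S5b tuned torus planting; S6 carries the power hypothesis.) [folklore] -/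
theorem SolitonTransplant_of :
    Summit.AnomalousDissipation.AnomalousDissipation.Theses.PointSink.SolitonTransplant := by
  intro hH
  obtain ⟨Q, P, hNS, hmass, hDint, hDpos, lam, V, hlam, hVm, hDSS, hVloc, hVpos, hshell⟩ := hH
  -- continuity of the soliton (classical solutions are smooth in space)
  have hQc : Continuous Q := (hNS.contDiff_velocity (Set.mem_univ (0 : ℝ))).continuous
  -- S1: integer-shell convergence of the rescalings
  have h1 := stub_shellDefectScaling Q V lam hlam hDSS hshell
  -- S2: local L² convergence off the origin
  have h2 := stub_localL2Convergence Q V lam hlam hQc hVm hVloc h1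
  -- S3: tested identities of the rescaled steady NS family, at μ = lam ^ k
  have h3 : ∀ k : ℕ, _ := fun k => stub_testedRescaledNS Q P hNS (lam ^ k) (pow_pos (by linarith) k)
  -- S4: the far field is a pressure-free weak Euler cone, weakly divergence free
  obtain ⟨hEuler, hwdiv⟩ := stub_farFieldWeakEuler Q V lam hlam hQc hVm hVloc h2
    (fun k => (h3 k).1) (fun k => (h3 k).2)
  -- S5a: the zero-force free-space sink completion
  obtain ⟨r₀, r₁, c, U₀, R₀, hr, hgerm₀, hR₀, hrest, hUs₀, hRs₀, hpos₀, hint₀, hdiv₀, hweak₀⟩ :=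
    stub_freeSpaceSinkCompletion lam V hlam hVm hDSS hVloc hVpos hEuler hwdiv
  -- S6b: the exact core family of the soliton
  obtain ⟨hνpos, hν0, hcore, hcoreInt, hcoreD, hcoreConc, hcoreL2⟩ :=
    stub_solitonCoreFamily Q P hNS hmass hDint lam V hlam hVm hDSS hVloc hshell
  -- S6a: design the stirring and realise steadily (the open wall)
  obtain ⟨f, x₀, ν, u, p, hfs, hfd, hfm, hν, hν0', hsol, hE, hε, hconc⟩ :=
    stub_relativeRealisationDesign lam V hlam hVm hDSS hVloc hVpos hEuler hwdiv r₀ r₁ c U₀ R₀ hr hgerm₀ hR₀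
      hrest hUs₀ hRs₀ hpos₀ hint₀ hdiv₀ hweak₀ (∫ x, frobeniusNormSq (fderiv ℝ Q x)) hDpos
      (fun j => (lam ^ j) ^ (-(1 / 3 : ℝ))) (fun j y => (lam ^ j) ^ (2 / 3 : ℝ) • Q (lam ^ j • y))
      (fun j y => (lam ^ j) ^ (4 / 3 : ℝ) * P (lam ^ j • y)) hνpos hν0 hcore hcoreInt hcoreD hcoreConc hcoreL2
  exact ⟨f, hfs, hfd, hfm, x₀, ν, u, p, hν, hν0', hsol, hE, hε, hconc⟩

end Summit.AnomalousDissipation.AnomalousDissipation.Cruxes.SolitonTransplant.Sketch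

end
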